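import Summits.CriticalPhenomena.PercolationContinuityZ3.Theorems.PercNearOneGluingNoHeavyLowerTailL1CertCols
import HarnessLib

/-!
# `NoHeavyLowerTail` (stmt-CriticalPhenomena-4575) — kernel replay of the (L1) certificate: the coefficientwise check (COMPILED evaluation)

Support file (prover seat `prim-bnk-1`, gen 3; `--supports stmt-CriticalPhenomena-4575`).  COMPUTATIONAL: ONE declaration, `check_all`, evaluated
by `native_decide` (axiom `Lean.ofReduceBool` / the per-declaration native axiom), exactly as `…CertEG3` does for the three-relay gluing
certificate.  Nothing else in the (L1) replay uses compiled evaluation: the structural identities (`…L1CertStruct`) are `decide +kernel`, the row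
validity and the assembly are ordinary proofs.

WHAT IS CHECKED.  `CertCheck.checkS certM tP tM rowsS`: after normalisation, the term list `M·T⁻ + Σ_r wt_r·m_r·g_r⁺` is dominated
coefficientwise by `M·T⁺ + Σ_r wt_r·m_r·g_r⁻` (≈ 1.9·10⁵ raw monomials; the difference is prim-l12-p6's slack, 2 430 nonnegative quintic
coefficients).  A pure-kernel `decide` of the same statement exceeds the kernel's memory bound (tried: bucketed, `maxRecDepth 200000`); the
elaborator's `Decidable.decide` evaluation succeeds, and this compiled evaluation takes ≈ 2 s.
-/

namespace Summit.CriticalPhenomena.PercolationContinuityZ3.Theorems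

namespace L1Cert

open CertCheck

set_option maxRecDepth 100000 in
/-- **The (L1) certificate passes the coefficientwise domination check** (compiled evaluation). [this work] -/
theorem check_all : checkS certM tP tM rowsS = true := by
  native_decide

end L1Cert

end Summit.CriticalPhenomena.PercolationContinuityZ3.Theorems
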